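import Summits.Ventures.WeilGRH.KeyParityTransfer
import Literature.NumberTheory.LFunctions.DirichletLZeroCountingCentralSlope
import Literature.Analysis.SpecialFunctions.DigammaVerticalSeries
import Literature.Analysis.SpecialFunctions.DigammaGauss
import Mathlib.NumberTheory.DirichletCharacter.Orthogonality
import Mathlib.RingTheory.RootsOfUnity.AlgebraicallyClosed
import Mathlib.Analysis.Complex.Polynomial.Basic
import HarnessLib

/-!
# GRH arm (rh-explicit, venture WeilGRH): the FAMILY AVERAGE of the twisted window forms is the CENTRE of the key polytope

Cell `rh-explicit`, WEIL TRACK — GRH ARM, sequel of `KeyPolytope.lean` / `KeyParityTransfer.lean` (keys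
`(a, L, v)`, analytic forms `E_{a,L,v,N}(g) = (1/2π)∫|ĝ(½+iτ)|² M_{a,L,v,N}(τ) dτ`,
`M_{a,L,v,N}(τ) = Re ψ(¼ + a/2 + iτ/2) + (L − log π) − ρ_{v,N}(τ)`; for a character `χ` mod `q`,
`E_{χ,N} = weilFinitePrimeQuadraticChar χ N = E_{a_χ, log q, χ, N}` and, for `q ≠ 1`,
`Re Q_χ(g) = E_{χ,N}(g)` on the window `tsupport g ⊆ [−t, t]`, `e^{2t} ≤ N + 1`).

**The zero key.** `v = 0` (every visible prime power carries the value `0`) is the centre of the key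
polytope of `KeyPolytope.lean`; its weight has no ripple: `M_{a,L,0,N}(τ) = Re ψ(¼ + a/2 + iτ/2) + L − log π`
(`weilFinitePrimeWeightKey_zero_key`).  Since `y ↦ Re ψ(σ + iy)` is minimal at `y = 0`
(`re_digamma_ofReal_le_re_digamma_add_mul_I`, from the series of Andrews–Askey–Roy (1.2.13); Yoshida 1992 §6
uses the case `σ = ¼`), Plancherel gives

  `E_{a,L,0,N}(g) ≥ (ψ(¼ + a/2) + L − log π) ‖g‖₂²`     (`weilFinitePrimeQuadraticKey_zero_key_ge`),

so the zero key is Weil-positive on EVERY window as soon as `L ≥ log π − ψ(¼ + a/2)`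
(`WeilPositivityOnKey.zero_key`): numerically `q ≥ 215.3…` for `a = 0` (`ψ(¼) = −γ − π/2 − 3 log 2`) and
`q ≥ 9.3…` for `a = 1` (`ψ(¾) = ψ(¼) + π`).  The even threshold `log q = log π − ψ(¼)` is EXACTLY the one
at which the even main term of `N(T, χ)` stops decreasing at the central point
(`DirichletLZeroCountingCentralSlope`: `N_sm'(0; q, 0) = (log q − log π + ψ(¼))/π`): the centre of the even
key polytope is positive at every window iff the even zero-counting main term is increasing at `T = 0`
(`zero_key_threshold_iff_centralSlope_nonneg`).

**Orthogonality.** For every modulus `q` (`NeZero q`) and `N ≤ q`, summing over ALL Dirichlet characters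
mod `q` kills the ripple (`Σ_χ χ(n) = 0` for `1 < n ≤ q`, Mathlib's `DirichletCharacter.sum_characters_eq_zero`):

  `Σ_{χ mod q} ρ_{χ,N}(τ) = 0`                      (`sum_weilPrimeRippleChar_eq_zero`),
  `Σ_{χ mod q} E_{χ,N}(g) = Σ_{χ mod q} E_{a_χ, log q, 0, N}(g)`   (`sum_weilFinitePrimeQuadraticChar_eq_sum_zero_key`):

the family average of the twisted forms on a window with `N ≤ q` visible integers is the (parity-mixed)
centre of the polytope.  Hence (`sum_weilFinitePrimeQuadraticChar_nonneg`) for `q ≥ 216` and `N ≤ q` the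
SUM over the family of the analytic forms is `≥ 0` for every test function on the window
`[−log(N+1)/2, log(N+1)/2]`, and in particular (`sum_re_weilQuadraticChar_nonneg`, `q ≠ 1`) so is
`Σ_χ Re Q_χ(g)`: Weil positivity holds ON AVERAGE over the characters mod `q ≥ 216` at every window
`t ≤ log(q+1)/2`, by orthogonality alone — every individual rung of the arm below that window is a statement
about the ripple `ρ_{χ,N}`, i.e. about how far a character sits from the centre of the polytope.
Everything is PROVED; no named facts; RH/GRH-free.

## References
* A. Weil, *Sur les "formules explicites" de la théorie des nombres premiers* (1952), (11) pp. 261–262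
  (the prime term is linear in the character values). [Weil1952FormulesExplicites]
* G. E. Andrews, R. Askey, R. Roy, *Special Functions*, CUP 1999, Thm 1.2.5 (1.2.13) (the series for `ψ`).
  [AndrewsAskeyRoy1999]
* H. Yoshida, *On Hermitian forms attached to zeta functions*, Adv. Stud. Pure Math. 21 (1992), §6 p. 309
  (`Re ψ(σ + it)` increasing in `t ≥ 0`). [Yoshida1992]
* H. L. Montgomery, R. C. Vaughan, *Multiplicative Number Theory I*, CUP 2007, (4.14)–(4.15) (orthogonality
  of characters), Theorem 14.5 (the main term of `N(T, χ)`). [MontgomeryVaughan2007]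
-/

noncomputable section

open Complex Set MeasureTheory
open scoped Real ArithmeticFunction.vonMangoldt

namespace Summit.Ventures.WeilGRH

open Literature.NumberTheory.LFunctions Literature.Analysis.SpecialFunctions.Complex

variable {q : ℕ} {g : ℝ → ℂ}

/-! ## `Re ψ(σ + iy)` is minimal on the real axis -/

/-- `Re (1/(s + iy)) = s/(s² + y²) ≤ 1/s = Re (1/s)` for `s > 0`. [folklore] -/
private theorem re_one_div_add_mul_I_le {s : ℝ} (hs : 0 < s) (y : ℝ) :
    (1 / ((s : ℂ) + y * I)).re ≤ (1 / (s : ℂ)).re := by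
  have e1 : (1 / ((s : ℂ) + y * I)).re = s / (s * s + y * y) := by
    rw [one_div, Complex.inv_re, Complex.normSq_apply]
    simp
  have e2 : (1 / (s : ℂ)).re = 1 / s := by
    rw [← Complex.ofReal_one, ← Complex.ofReal_div, Complex.ofReal_re]
  rw [e1, e2, div_le_div_iff₀ (add_pos_of_pos_of_nonneg (mul_pos hs hs) (mul_self_nonneg y)) hs]
  nlinarith [sq_nonneg y]

/-- **`ψ(σ) ≤ Re ψ(σ + iy)` for `σ > 0` and every real `y`**: termwise in Andrews–Askey–Roy (1.2.13),
`Re ψ(σ + iy) − ψ(σ) = Σ_k y²/((σ+k)((σ+k)² + y²)) ≥ 0` (Yoshida 1992 §6 at `σ = ¼`).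
[cite: AndrewsAskeyRoy1999, Thm 1.2.5 (1.2.13); Yoshida1992, §6 (p. 309)] -/
theorem re_digamma_ofReal_le_re_digamma_add_mul_I {σ : ℝ} (hσ : 0 < σ) (y : ℝ) :
    (Complex.digamma σ).re ≤ (Complex.digamma (σ + y * I)).re := by
  have hw1 : 0 < ((σ : ℂ) + y * I).re := by simpa using hσ
  have hw0 : 0 < ((σ : ℂ)).re := by simpa using hσ
  have h1 := (hasSum_one_div_sub_one_div_digamma hw1).mapL Complex.reCLM
  have h0 := (hasSum_one_div_sub_one_div_digamma hw0).mapL Complex.reCLM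
  simp only [Complex.reCLM_apply] at h1 h0
  have hle : ∀ k : ℕ, (fun k : ℕ ↦ (1 / ((k : ℂ) + 1) - 1 / ((σ : ℂ) + k)).re) k ≤
      (fun k : ℕ ↦ (1 / ((k : ℂ) + 1) - 1 / ((σ : ℂ) + y * I + k)).re) k := by
    intro k
    simp only [Complex.sub_re, sub_le_sub_iff_left]
    have hs : 0 < σ + k := by positivity
    have e1 : (σ : ℂ) + y * I + k = ((σ + k : ℝ) : ℂ) + y * I := by push_cast; ring
    have e0 : (σ : ℂ) + k = ((σ + k : ℝ) : ℂ) := by push_cast; ring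
    rw [e1, e0]
    exact re_one_div_add_mul_I_le hs y
  have h := hasSum_le hle h0 h1
  simpa [Complex.add_re, Complex.ofReal_re] using h

/-- On the arm's lines: `ψ(¼ + a/2) ≤ Re ψ(¼ + a/2 + iτ/2)` for every parity `a` and real `τ`.
[cite: Yoshida1992, §6 (p. 309)] -/
theorem re_digamma_parity_line_ge (a : ℕ) (τ : ℝ) :
    (Complex.digamma ((1 / 4 + (a : ℝ) / 2 : ℝ) : ℂ)).re ≤
      (Complex.digamma (1 / 4 + (a : ℂ) / 2 + τ / 2 * I)).re := by
  have h := re_digamma_ofReal_le_re_digamma_add_mul_I (σ := 1 / 4 + (a : ℝ) / 2) (by positivity) (τ / 2)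
  have e : (((1 / 4 + (a : ℝ) / 2 : ℝ) : ℂ) + ((τ / 2 : ℝ) : ℂ) * I) = 1 / 4 + (a : ℂ) / 2 + τ / 2 * I := by
    push_cast; ring
  rwa [e] at h

/-! ## The zero key (centre of the polytope) -/

/-- The zero key has no ripple: `ρ_{0,N} = 0`. [folklore] -/
theorem weilPrimeRippleKey_zero (N : ℕ) (τ : ℝ) : weilPrimeRippleKey 0 N τ = 0 := by
  unfold weilPrimeRippleKey
  simp

/-- `M_{a,L,0,N}(τ) = Re ψ(¼ + a/2 + iτ/2) + (L − log π)`. [folklore] -/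
theorem weilFinitePrimeWeightKey_zero_key (a : ℕ) (L : ℝ) (N : ℕ) (τ : ℝ) :
    weilFinitePrimeWeightKey a L 0 N τ =
      (Complex.digamma (1 / 4 + (a : ℂ) / 2 + τ / 2 * I)).re + (L - Real.log π) := by
  unfold weilFinitePrimeWeightKey
  rw [weilPrimeRippleKey_zero, sub_zero]

/-- The zero-key weight is bounded below by its value at `τ = 0`:
`ψ(¼ + a/2) + L − log π ≤ M_{a,L,0,N}(τ)`. [cite: Yoshida1992, §6 (p. 309)] -/
theorem weilFinitePrimeWeightKey_zero_key_ge (a : ℕ) (L : ℝ) (N : ℕ) (τ : ℝ) :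
    (Complex.digamma ((1 / 4 + (a : ℝ) / 2 : ℝ) : ℂ)).re + (L - Real.log π) ≤
      weilFinitePrimeWeightKey a L 0 N τ := by
  rw [weilFinitePrimeWeightKey_zero_key]
  have := re_digamma_parity_line_ge a τ
  linarith

/-- **The centre of the polytope, bounded below**: for every test function `g`,
`(ψ(¼ + a/2) + L − log π)·‖g‖₂² ≤ E_{a,L,0,N}(g)` (Plancherel `(1/2π)∫|ĝ(½+iτ)|² = ‖g‖₂²`).
[cite: Yoshida1992, §6 (p. 309); Weil1952FormulesExplicites, (11) pp. 261–262] -/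
theorem weilFinitePrimeQuadraticKey_zero_key_ge (hg : IsWeilTest g) (a : ℕ) (L : ℝ) (N : ℕ) :
    ((Complex.digamma ((1 / 4 + (a : ℝ) / 2 : ℝ) : ℂ)).re + (L - Real.log π)) * weilNorm2Sq g ≤
      weilFinitePrimeQuadraticKey a L 0 N g := by
  unfold weilFinitePrimeQuadraticKey
  set c : ℝ := (Complex.digamma ((1 / 4 + (a : ℝ) / 2 : ℝ) : ℂ)).re + (L - Real.log π) with hc
  have hI := integrable_norm_sq_weilMellin_mul_weilFinitePrimeWeightKey hg a L 0 N
  have hc' := (integrable_norm_sq_weilMellin_half_line hg).mul_const c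
  have hle : ∫ τ : ℝ, ‖weilMellin g (1 / 2 + τ * I)‖ ^ 2 * c ≤
      ∫ τ : ℝ, ‖weilMellin g (1 / 2 + τ * I)‖ ^ 2 * weilFinitePrimeWeightKey a L 0 N τ :=
    integral_mono hc' hI fun τ ↦ mul_le_mul_of_nonneg_left
      (weilFinitePrimeWeightKey_zero_key_ge a L N τ) (by positivity)
  rw [integral_mul_const, integral_norm_sq_weilMellin_half_line hg] at hle
  have hπ := Real.pi_pos
  calc c * weilNorm2Sq g = 1 / (2 * π) * (2 * π * weilNorm2Sq g * c) := by field_simp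
    _ ≤ 1 / (2 * π) * ∫ τ : ℝ, ‖weilMellin g (1 / 2 + τ * I)‖ ^ 2 * weilFinitePrimeWeightKey a L 0 N τ := by
        gcongr

/-- **The centre of the key polytope is Weil-positive at every window once `L ≥ log π − ψ(¼ + a/2)`**
(`q ≥ 215.3…` for even parity, `q ≥ 9.3…` for odd). [cite: Yoshida1992, §6 (p. 309)] -/
theorem WeilPositivityOnKey.zero_key {a : ℕ} {L : ℝ}
    (hL : Real.log π - (Complex.digamma ((1 / 4 + (a : ℝ) / 2 : ℝ) : ℂ)).re ≤ L) (N : ℕ) :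
    WeilPositivityOnKey a L 0 N := by
  intro g hg _
  have h := weilFinitePrimeQuadraticKey_zero_key_ge hg a L N
  have hn := weilNorm2Sq_nonneg g
  nlinarith

/-- **The even threshold is the central-slope threshold**: `log π − ψ(¼) ≤ log q` iff the even main term
of `N(T, χ)` (MV Theorem 14.5) has non-negative slope at `T = 0`,
`0 ≤ N_sm'(0; q, 0) = (log q − log π + ψ(¼))/π` (`DirichletLZeroCountingCentralSlope`).
[cite: MontgomeryVaughan2007, Theorem 14.5 with (C.11)] -/
theorem zero_key_threshold_iff_centralSlope_nonneg (q : ℕ) :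
    Real.log π - (Complex.digamma ((1 / 4 + ((0 : ℕ) : ℝ) / 2 : ℝ) : ℂ)).re ≤ Real.log q ↔
      0 ≤ deriv (fun T : ℝ ↦ (2 * DirichletTheta.gammaArgPhase 0 T + T * Real.log q) / Real.pi) 0 := by
  rw [DirichletTheta.deriv_zeroCountingMainTerm_zero 0 q]
  have e : ((((1 / 2 + ((0 : ℕ) : ℝ) : ℝ)) : ℂ) / 2) = (((1 / 4 + ((0 : ℕ) : ℝ) / 2 : ℝ)) : ℂ) := by
    push_cast; ring
  rw [e]
  have hπ := Real.pi_pos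
  constructor
  · intro h; exact div_nonneg (by linarith) hπ.le
  · intro h
    have := (div_nonneg_iff.1 h)
    rcases this with ⟨h1, _⟩ | ⟨_, h2⟩
    · linarith
    · linarith

/-! ## Orthogonality: the family sum kills the ripple -/

/-- For `1 < n ≤ q`, `(n : ZMod q) ≠ 1`. [folklore] -/
private theorem natCast_zmod_ne_one {n : ℕ} (h1 : 1 < n) (h2 : n ≤ q) : ((n : ZMod q)) ≠ 1 := by
  intro h
  have hq : 1 < q := lt_of_lt_of_le h1 h2
  have key := (ZMod.natCast_eq_natCast_iff' n 1 q)
  rw [Nat.cast_one] at key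
  rw [key, Nat.mod_eq_of_lt hq] at h
  rcases Nat.lt_or_ge n q with hn | hn
  · rw [Nat.mod_eq_of_lt hn] at h; omega
  · have : n = q := le_antisymm h2 hn
    subst this
    simp at h

/-- **`Σ_{χ mod q} χ(n) = 0` for `1 < n ≤ q`** (orthogonality of characters).
[cite: MontgomeryVaughan2007, (4.14)–(4.15)] -/
theorem sum_char_apply_eq_zero [NeZero q] {n : ℕ} (h1 : 1 < n) (h2 : n ≤ q) :
    ∑ χ : DirichletCharacter ℂ q, χ (n : ZMod q) = 0 :=
  DirichletCharacter.sum_characters_eq_zero ℂ (natCast_zmod_ne_one h1 h2)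

/-- **The family sum of the ripples vanishes** when only `n ≤ N ≤ q` are visible:
`Σ_{χ mod q} ρ_{χ,N}(τ) = 0` (`Λ(0) = Λ(1) = 0`, and `Σ_χ χ(n) = 0` for `1 < n ≤ q`).
[cite: MontgomeryVaughan2007, (4.14)–(4.15); Weil1952FormulesExplicites, (11) pp. 261–262 (prime term linear in χ)] -/
theorem sum_weilPrimeRippleChar_eq_zero [NeZero q] {N : ℕ} (hN : N ≤ q) (τ : ℝ) :
    ∑ χ : DirichletCharacter ℂ q, weilPrimeRippleChar χ N τ = 0 := by
  unfold weilPrimeRippleChar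
  rw [Finset.sum_comm]
  refine Finset.sum_eq_zero fun n hn ↦ ?_
  have hnN : n ≤ N := Nat.lt_succ_iff.1 (Finset.mem_range.1 hn)
  rcases Nat.lt_or_ge 1 n with h1 | h1
  · -- 1 < n ≤ q: orthogonality
    have hs := sum_char_apply_eq_zero (q := q) h1 (hnN.trans hN)
    have hre : ∑ χ : DirichletCharacter ℂ q, (χ (n : ZMod q)).re = 0 := by
      rw [← Complex.re_sum, hs, Complex.zero_re]
    have him : ∑ χ : DirichletCharacter ℂ q, (χ (n : ZMod q)).im = 0 := by
      rw [← Complex.im_sum, hs, Complex.zero_im]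
    have e : ∑ χ : DirichletCharacter ℂ q, (Λ n : ℝ) / Real.sqrt n *
        (2 * ((χ (n : ZMod q)).re * Real.cos (τ * Real.log n) +
          (χ (n : ZMod q)).im * Real.sin (τ * Real.log n))) =
        (Λ n : ℝ) / Real.sqrt n * (2 * ((∑ χ : DirichletCharacter ℂ q, (χ (n : ZMod q)).re) *
          Real.cos (τ * Real.log n) +
          (∑ χ : DirichletCharacter ℂ q, (χ (n : ZMod q)).im) * Real.sin (τ * Real.log n))) := by
      rw [Finset.sum_mul, Finset.sum_mul, ← Finset.sum_add_distrib, Finset.mul_sum, Finset.mul_sum]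
    rw [e, hre, him]
    ring
  · -- n ≤ 1: Λ(n) = 0
    interval_cases n <;> simp [ArithmeticFunction.vonMangoldt_apply_one, ArithmeticFunction.map_zero]

/-- Each character's form is the zero key of its parity minus the ripple form:
`E_{χ,N}(g) = E_{a_χ, log q, 0, N}(g) − (1/2π)∫|ĝ(½+iτ)|² ρ_{χ,N}(τ) dτ`. [folklore] -/
theorem weilFinitePrimeQuadraticChar_eq_zero_key_sub (hg : IsWeilTest g) (χ : DirichletCharacter ℂ q)
    (N : ℕ) :
    weilFinitePrimeQuadraticChar χ N g =
      weilFinitePrimeQuadraticKey (charParity χ) (Real.log q) 0 N g -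
        1 / (2 * π) * ∫ τ : ℝ, ‖weilMellin g (1 / 2 + τ * I)‖ ^ 2 * weilPrimeRippleChar χ N τ := by
  unfold weilFinitePrimeQuadraticChar weilFinitePrimeQuadraticKey
  have h0 := integrable_norm_sq_weilMellin_mul_weilFinitePrimeWeightKey hg (charParity χ) (Real.log q) 0 N
  have hr := (integral_norm_sq_weilMellin_mul_weilPrimeRippleChar hg χ N).1
  have e : (fun τ : ℝ ↦ ‖weilMellin g (1 / 2 + τ * I)‖ ^ 2 * weilFinitePrimeWeightChar χ N τ) =
      fun τ : ℝ ↦ ‖weilMellin g (1 / 2 + τ * I)‖ ^ 2 * weilFinitePrimeWeightKey (charParity χ) (Real.log q) 0 N τ -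
        ‖weilMellin g (1 / 2 + τ * I)‖ ^ 2 * weilPrimeRippleChar χ N τ := by
    funext τ
    rw [weilFinitePrimeWeightKey_zero_key]
    unfold weilFinitePrimeWeightChar
    ring
  rw [e, integral_sub h0 hr, mul_sub]

/-- **THE FAMILY AVERAGE IS THE CENTRE OF THE POLYTOPE.**  For `N ≤ q` and every test function `g`,
`Σ_{χ mod q} E_{χ,N}(g) = Σ_{χ mod q} E_{a_χ, log q, 0, N}(g)` — each twisted form replaced by the zero key
of its parity. [cite: MontgomeryVaughan2007, (4.14)–(4.15); Weil1952FormulesExplicites, (11) pp. 261–262] -/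
theorem sum_weilFinitePrimeQuadraticChar_eq_sum_zero_key [NeZero q] (hg : IsWeilTest g) {N : ℕ}
    (hN : N ≤ q) :
    ∑ χ : DirichletCharacter ℂ q, weilFinitePrimeQuadraticChar χ N g =
      ∑ χ : DirichletCharacter ℂ q, weilFinitePrimeQuadraticKey (charParity χ) (Real.log q) 0 N g := by
  simp_rw [weilFinitePrimeQuadraticChar_eq_zero_key_sub hg _ N]
  rw [Finset.sum_sub_distrib, ← Finset.mul_sum,
    ← integral_finsetSum _ (fun χ _ ↦ (integral_norm_sq_weilMellin_mul_weilPrimeRippleChar hg χ N).1)]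
  have e : (fun τ : ℝ ↦ ∑ χ : DirichletCharacter ℂ q,
      ‖weilMellin g (1 / 2 + τ * I)‖ ^ 2 * weilPrimeRippleChar χ N τ) = fun _ ↦ 0 := by
    funext τ
    rw [← Finset.mul_sum, sum_weilPrimeRippleChar_eq_zero hN τ, mul_zero]
  rw [e, integral_zero, mul_zero, sub_zero]

/-! ## Family positivity above the threshold -/

/-- `log 3 > 1.0985` (eight terms of the series for `log(1 − 1/3) = log 2 − log 3`; the same computation as
`Literature.NumberTheory.Sieve.FriedlanderIwaniecPrimesSeparationLemma.log_three_gt'`, not imported here).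
[folklore] -/
private theorem log_three_gt_d4 : (1.0985 : ℝ) < Real.log 3 := by
  have h := Real.abs_log_sub_add_sum_range_le (x := (1 / 3 : ℝ))
    (by rw [abs_of_pos (by norm_num)]; norm_num) 8
  rw [abs_of_pos (by norm_num : (0 : ℝ) < 1 / 3)] at h
  have hs : ∑ i ∈ Finset.range 8, (1 / 3 : ℝ) ^ (i + 1) / (i + 1) = 744857 / 1837080 := by
    simp only [Finset.sum_range_succ, Finset.sum_range_zero]
    norm_num
  rw [hs, show (1 : ℝ) - 1 / 3 = 2 / 3 by norm_num, Real.log_div (by norm_num) (by norm_num)] at h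
  have h2 := Real.log_two_gt_d9
  have h' := (abs_le.1 h).2
  norm_num at h'
  linarith

/-- `5.3722 ≤ log 216` (`216 = 2³·3³`). [folklore] -/
private theorem log_216_ge : (5.3722 : ℝ) ≤ Real.log 216 := by
  have e : Real.log 216 = 3 * Real.log 2 + 3 * Real.log 3 := by
    rw [show (216 : ℝ) = 2 ^ 3 * 3 ^ 3 by norm_num, Real.log_mul (by norm_num) (by norm_num),
      Real.log_pow, Real.log_pow]
    push_cast
    ring
  rw [e]
  have h2 := Real.log_two_gt_d9
  have h3 := log_three_gt_d4
  linarith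

/-- `log π − ψ(¼) ≤ 5.37218344 ≤ log 216`, so `log π − ψ(¼ + a/2) ≤ log q` for both parities once
`q ≥ 216` (`ψ(¾) = ψ(¼) + π`; tree bounds `re_digamma_one_quarter_ge`, `Real.log_pi_le`); the even
threshold `e^{log π − ψ(¼)} = 215.33…` makes `216` sharp for this argument. [folklore] -/
theorem zero_key_threshold_of_ge_216 (hq : 216 ≤ q) (a : ℕ) (ha : a ≤ 1) :
    Real.log π - (Complex.digamma ((1 / 4 + (a : ℝ) / 2 : ℝ) : ℂ)).re ≤ Real.log q := by
  have h1 := Literature.Analysis.SpecialFunctions.re_digamma_one_quarter_ge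
  have h2 := Literature.Analysis.SpecialFunctions.Real.log_pi_le
  have hlog : (5.3722 : ℝ) ≤ Real.log q := by
    have h216 : (216 : ℝ) ≤ q := by exact_mod_cast hq
    exact log_216_ge.trans (Real.log_le_log (by norm_num) h216)
  interval_cases a
  · have e : (((1 / 4 + ((0 : ℕ) : ℝ) / 2 : ℝ)) : ℂ) = (1 / 4 : ℂ) := by push_cast; norm_num
    rw [e]
    linarith
  · have hπ := digamma_three_quarters_sub_digamma_one_quarter
    have hre := congrArg Complex.re hπ
    rw [Complex.sub_re, Complex.ofReal_re] at hre
    have e : (((1 / 4 + ((1 : ℕ) : ℝ) / 2 : ℝ)) : ℂ) = (3 / 4 : ℂ) := by push_cast; norm_num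
    rw [e]
    have := Real.pi_pos
    linarith

/-- **WEIL POSITIVITY ON AVERAGE OVER THE FAMILY.**  For `q ≥ 216`, `N ≤ q` and every test function `g`:
`0 ≤ Σ_{χ mod q} E_{χ,N}(g)`. [cite: Weil1952FormulesExplicites, (11) pp. 261–262; MontgomeryVaughan2007, (4.14)–(4.15)] -/
theorem sum_weilFinitePrimeQuadraticChar_nonneg [NeZero q] (hq : 216 ≤ q) (hg : IsWeilTest g) {N : ℕ}
    (hN : N ≤ q) : 0 ≤ ∑ χ : DirichletCharacter ℂ q, weilFinitePrimeQuadraticChar χ N g := by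
  rw [sum_weilFinitePrimeQuadraticChar_eq_sum_zero_key hg hN]
  refine Finset.sum_nonneg fun χ _ ↦ ?_
  have ha : charParity χ ≤ 1 := by unfold charParity; split_ifs <;> omega
  have h := weilFinitePrimeQuadraticKey_zero_key_ge hg (charParity χ) (Real.log q) N
  have ht := zero_key_threshold_of_ge_216 hq (charParity χ) ha
  have hn := weilNorm2Sq_nonneg g
  nlinarith

/-- The same for the twisted functionals themselves: for `q ≥ 216`, every window `[−t, t]` with
`e^{2t} ≤ q + 1` and every test function `g` on it, `0 ≤ Σ_{χ mod q} Re Q_χ(g)`.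
[cite: Weil1952FormulesExplicites, the «lemme» p. 262 and (11); MontgomeryVaughan2007, (4.14)–(4.15)] -/
theorem sum_re_weilQuadraticChar_nonneg [NeZero q] (hq : 216 ≤ q) (hg : IsWeilTest g) {t : ℝ}
    (ht : Real.exp (2 * t) ≤ (q : ℝ) + 1) (hsupp : tsupport g ⊆ Icc (-t) t) :
    0 ≤ ∑ χ : DirichletCharacter ℂ q, (weilQuadraticChar χ g).re := by
  have hq1 : q ≠ 1 := by omega
  have e : ∀ χ : DirichletCharacter ℂ q, (weilQuadraticChar χ g).re = weilFinitePrimeQuadraticChar χ q g :=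
    fun χ ↦ weilQuadraticChar_re_eq_weilFinitePrimeQuadraticChar hq1 χ hg ht hsupp
  simp_rw [e]
  exact sum_weilFinitePrimeQuadraticChar_nonneg hq hg le_rfl

end Summit.Ventures.WeilGRH
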